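import Mathlib

/-!
# Schoen carrier pairings — the alternating-sum collapse (W3 / pub-hsemireg, seat w3-prym-2 g6)

Honest framing: nothing here says HC / HC_CM / HC_AV is proved.  This file is the kernel-checked
combinatorial core of the closed forms in `W3-LOCAL-READ-w3prym2.md` §1 / `W3-DPFINE-w3prym2.md`
§3 (3): with the carrier class `[X̃_t] ≡ 3^{d-1} Σ_k (-1)^{d-k} x^{d-k} θ_inv^k / k!` and the pairing
rule `∫ x^{N-i-j} θ_inv^i θ_P^j = i! j! C(d+1,i) C(2d,j)`, every pairing `∫_{X̃_t} x^j θ_inv^a θ_P^b`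
reduces to the alternating sum

  `Σ_{k=0}^{d} (-1)^{d+k} C(k+a, a) C(d+1, k+a)`,

which this file proves to be `1` for `a = 0` and `0` for `1 ≤ a ≤ d` (so `∫ x^{d-b} θ_P^b =
3^{d-1} b! C(2d,b)`, e.g. LEMMA Γ's `∫ x^{d-1} θ_P = 2d·3^{d-1}`, and the θ_inv-vanishing
`∫ x^j θ_inv^a θ_P^b = 0` for `a ≥ 1`).  The identity is `C(d+1,k+a) C(k+a,a) = C(d+1,a) C(d+1-a,k)`
(`Nat.choose_mul`) followed by the vanishing of a full alternating row of Pascal's triangle.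
The intersection-theoretic inputs themselves are NOT formalised here.
-/

namespace Summit.Ventures.HSemireg.CarrierPairings

open Finset

/-- A full alternating row of Pascal's triangle summed over a possibly longer range:
`Σ_{k=0}^{m} (-1)^k C(n,k) = 0` whenever `1 ≤ n ≤ m`. -/
theorem alternating_sum_choose_range_of_le {n m : ℕ} (hn : n ≠ 0) (hm : n ≤ m) :
    ∑ k ∈ range (m + 1), (-1 : ℤ) ^ k * (n.choose k : ℤ) = 0 := by
  obtain ⟨j, rfl⟩ := Nat.exists_eq_add_of_le hm
  induction j with
  | zero => simpa using Int.alternating_sum_range_choose_of_ne hn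
  | succ j ih =>
    rw [show n + (j + 1) + 1 = (n + j + 1) + 1 by ring, sum_range_succ, ih (Nat.le_add_right n j),
      Nat.choose_eq_zero_of_lt (by omega)]
    simp

/-- The re-indexing identity `C(d+1, k+a) · C(k+a, a) = C(d+1, a) · C(d+1-a, k)`. -/
theorem choose_shift_mul (d a k : ℕ) :
    (((d + 1).choose (k + a) : ℕ) : ℤ) * (((k + a).choose a : ℕ) : ℤ)
      = (((d + 1).choose a : ℕ) : ℤ) * (((d + 1 - a).choose k : ℕ) : ℤ) := by
  have h := Nat.choose_mul (n := d + 1) (k := k + a) (s := a) (Nat.le_add_left a k)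
  rw [Nat.add_sub_cancel] at h
  exact_mod_cast h

/-- THE COLLAPSE (θ_inv-vanishing in pairing form): for `1 ≤ a ≤ d`,
`Σ_{k=0}^{d} (-1)^k C(d+1, k+a) C(k+a, a) = 0`. -/
theorem alternating_collapse {d a : ℕ} (ha : 1 ≤ a) (had : a ≤ d) :
    ∑ k ∈ range (d + 1), (-1 : ℤ) ^ k * (((d + 1).choose (k + a) : ℕ) : ℤ) * (((k + a).choose a : ℕ) : ℤ) = 0 := by
  calc ∑ k ∈ range (d + 1), (-1 : ℤ) ^ k * (((d + 1).choose (k + a) : ℕ) : ℤ) * (((k + a).choose a : ℕ) : ℤ)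
      = ∑ k ∈ range (d + 1), (((d + 1).choose a : ℕ) : ℤ) * ((-1 : ℤ) ^ k * (((d + 1 - a).choose k : ℕ) : ℤ)) := by
        refine sum_congr rfl fun k _ => ?_
        rw [mul_assoc, choose_shift_mul]
        ring
    _ = (((d + 1).choose a : ℕ) : ℤ) * ∑ k ∈ range (d + 1), (-1 : ℤ) ^ k * (((d + 1 - a).choose k : ℕ) : ℤ) := by
        rw [mul_sum]
    _ = 0 := by
        rw [alternating_sum_choose_range_of_le (n := d + 1 - a) (m := d) (by omega) (by omega), mul_zero]

/-- THE PAIRING IDENTITY in the form used by the notes (sign `(-1)^{d+k} = (-1)^{d-k}`):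
for `a ≤ d`, `Σ_{k=0}^{d} (-1)^{d+k} C(k+a, a) C(d+1, k+a) = [a = 0]`.  With the recipe's inputs this
is `∫_{X̃_t} x^{d-a-b} θ_inv^a θ_P^b = [a = 0] · 3^{d-1} b! C(2d, b)`. -/
theorem pairing_collapse {d a : ℕ} (had : a ≤ d) :
    ∑ k ∈ range (d + 1), (-1 : ℤ) ^ (d + k) * (((k + a).choose a : ℕ) : ℤ) * (((d + 1).choose (k + a) : ℕ) : ℤ)
      = if a = 0 then 1 else 0 := by
  have hrw : ∀ k, (-1 : ℤ) ^ (d + k) * (((k + a).choose a : ℕ) : ℤ) * (((d + 1).choose (k + a) : ℕ) : ℤ)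
      = (-1 : ℤ) ^ d * ((-1 : ℤ) ^ k * (((d + 1).choose (k + a) : ℕ) : ℤ) * (((k + a).choose a : ℕ) : ℤ)) := by
    intro k
    rw [pow_add]
    ring
  simp_rw [hrw, ← mul_sum]
  split_ifs with h0
  · subst h0
    have h := (Int.alternating_sum_range_choose_eq_choose (n := d) (m := d))
    simp only [add_zero, Nat.choose_zero_right, Nat.cast_one, mul_one]
    rw [h, Nat.choose_self, Nat.cast_one, mul_one, ← pow_add, ← two_mul, pow_mul]
    norm_num
  · rw [alternating_collapse (Nat.one_le_iff_ne_zero.mpr h0) had, mul_zero]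

/-- Sanity instances: `d = 4` (the `g = 8` rung), `a = 0, 1, 2`. -/
theorem pairing_collapse_examples :
    (∑ k ∈ range 5, (-1 : ℤ) ^ (4 + k) * (((k + 0).choose 0 : ℕ) : ℤ) * (((5 : ℕ).choose (k + 0) : ℕ) : ℤ) = 1) ∧
    (∑ k ∈ range 5, (-1 : ℤ) ^ (4 + k) * (((k + 1).choose 1 : ℕ) : ℤ) * (((5 : ℕ).choose (k + 1) : ℕ) : ℤ) = 0) ∧
    (∑ k ∈ range 5, (-1 : ℤ) ^ (4 + k) * (((k + 2).choose 2 : ℕ) : ℤ) * (((5 : ℕ).choose (k + 2) : ℕ) : ℤ) = 0) := by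
  refine ⟨?_, ?_, ?_⟩ <;> decide

end Summit.Ventures.HSemireg.CarrierPairings
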